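import Mathlib.NumberTheory.RamificationInertia.Galois
import Mathlib.FieldTheory.Galois.Basic
import Mathlib.RingTheory.Flat.TorsionFree
import Literature.NumberTheory.GaloisRepresentations.RamificationFiltration
import HarnessLib

/-!
# Hilbert theory under residue separability; orders and uniformizers in Dedekind domains (trunk GalRep, item C9)

Commutative-algebra inputs for the global proof of Herbrand's theorem
(`RamificationFiltrationHerbrandQuotientProofs.lean`), stated for a finite group acting on a ring
with Mathlib's `IsGaloisGroup` / `Algebra.IsInvariant` and for Dedekind domains:

* `card_inertia_eq_ramificationIdxIn_of_isSeparable`: `Card(T_𝔓) = e(𝔓|𝔭)` for maximal ideals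
  with *separable* residue extension (Mathlib's `Ideal.card_inertia_eq_ramificationIdxIn` assumes
  a perfect residue field); with `Card(D_𝔓) = Card(T_𝔓) f` (Serre, Ch. I §7, Prop. 20–21).
* `exists_inertia_fixed_sub_mem`: every residue class mod `𝔓` contains an element fixed by the
  whole inertia group (`K̄_T = L̄`, Serre Ch. I §7 Prop. 21 c) / Cor.), from the normality of
  residue extensions and surjectivity `D → Aut` in Mathlib's invariant theory.
* `ord P b = emultiplicity P (span {b}) : ℕ∞`, the `𝔓`-adic order of an element of a Dedekind
  domain, with `mem_pow_iff_le_ord`, `ord_mul`, `ord_prod`, `ord_pow`, `ord_smul`, `ord_neg`,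
  `ord_eq_one`; `exists_eq_pow_mul_add_of_mem_pow` (`𝔓ᵏ = (ϖᵏ) + 𝔓ᵏ⁺¹`);
  `exists_polynomial_sub_eval_mem_pow` (expansion in a uniformizer modulo `𝔓ⁿ`);
  `mem_pow_of_sum_mem_pow` (terms with pairwise distinct orders).
* `forall_smul_sub_mem_pow_iff`, `mem_ramificationSubgroup_iff_smul_sub_mem_pow`: the
  **uniformizer criterion** `σ ≡ 1 mod 𝔓ⁿ ⇔ σ ϖ ≡ ϖ mod 𝔓ⁿ` for `σ` in the decomposition group
  whose residue classes have `σ`-fixed representatives (Serre, Ch. IV §1 Lemma 1 / §2 Prop. 5,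
  with the generator of `A_L` replaced by a uniformizer).
* For an intermediate field `F` of a finite Galois extension `L/K` of the fraction field of a
  Dedekind domain `R`: the `S_F`-algebra structure on `S_L` (`integralClosureAlgebra`, a local
  instance), `isGaloisGroup_fixingSubgroup_integralClosure`,
  `ramificationIdx'_under_eq_card_inertia` (`e(𝔓 | 𝔓 ∩ F) = Card(T_𝔓 ∩ Gal(L/F))`) and
  `ord_algebraMap_integralClosure` (`v_𝔓 = e · v_{𝔓 ∩ F}` on `S_F`).

## References

* J.-P. Serre, *Local Fields*, GTM 67, Springer 1979: Ch. I §4 (prolongation of valuations with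
  index `e`), §7 Prop. 20, 21 and Cor., Prop. 22; Ch. IV §1 Lemma 1, §2 Prop. 5.
  [SerreLocalFields1979]

## Design notes

All residue fields are handled as quotients `R ⧸ p` by maximal ideals with Mathlib's scoped
`Ideal.Quotient.field`; separability hypotheses are phrased as
`Algebra.IsSeparable (R ⧸ p) (S ⧸ P)`, the form used by `Literature.NumberTheory.GaloisRepresentations.herbrand_quotient`.  The algebra
`S_F → S_L` and its residue algebra are `abbrev`s registered as *local* instances only (no global
instance is added), with a shortcut `SMul` instance to keep instance search fast.
-/

noncomputable section

open scoped Pointwise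

namespace Literature.NumberTheory.GaloisRepresentations

/-! ### `Card(T) = e` and `Card(D) = e f` when the residue extension is separable -/

section CardInertia

variable {R S G : Type*} [CommRing R] [CommRing S] [Algebra R S] [Group G] [MulSemiringAction G S]
  [IsGaloisGroup G R S] [Finite G]

/-- `Card(D_𝔓) = Card(T_𝔓) · f(𝔓|𝔭)` for a finite Galois group `G` of `S/R` and maximal ideals
`𝔓 | 𝔭` with *separable* residue extension (Mathlib's
`Ideal.card_stabilizer_eq_card_inertia_mul_finrank` assumes a perfect residue field instead).
Proof: `D/T ≅ Aut((S/𝔓)/(R/𝔭))` (Mathlib `Ideal.Quotient.stabilizerQuotientInertiaEquiv`), the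
residue extension is normal (`Ideal.Quotient.normal`), hence Galois.
Ref: Serre, *Local Fields*, Ch. I §7, Prop. 20 and Cor. to Prop. 21. [cite: SerreLocalFields1979, Ch. I §7 Prop. 20–21] -/
theorem card_stabilizer_eq_card_inertia_mul_inertiaDeg_of_isSeparable (p : Ideal R) [p.IsMaximal]
    (P : Ideal S) [P.LiesOver p] [P.IsMaximal] [Algebra.IsSeparable (R ⧸ p) (S ⧸ P)] :
    Nat.card (MulAction.stabilizer G P) = Nat.card (P.inertia G) * P.inertiaDeg R := by
  letI : Field (R ⧸ p) := Ideal.Quotient.field p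
  letI : Field (S ⧸ P) := Ideal.Quotient.field P
  haveI : Normal (R ⧸ p) (S ⧸ P) := Ideal.Quotient.normal G p P
  haveI : IsGalois (R ⧸ p) (S ⧸ P) := IsGalois.mk
  haveI : Finite ((S ⧸ P) ≃ₐ[R ⧸ p] (S ⧸ P)) :=
    Finite.of_surjective _ (Ideal.Quotient.stabilizerHom_surjective G p P)
  haveI : FiniteDimensional (R ⧸ p) (S ⧸ P) := IsGalois.finiteDimensional_of_finite _ _
  have hidx : Subgroup.index _ = _ :=
    Nat.card_congr (Ideal.Quotient.stabilizerQuotientInertiaEquiv G p P).toEquiv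
  rw [Ideal.inertiaDeg_eq_of_isMaximal p P, ← IsGalois.card_aut_eq_finrank, ← hidx,
    ← ((P.inertia G).subgroupOf (MulAction.stabilizer G P)).card_mul_index,
    Nat.card_congr (Subgroup.subgroupOfEquivOfLe (Ideal.inertia_le_stabilizer (M := G) P)).toEquiv,
    AddSubgroup.subgroupOf_inertia]

/-- `g · Card(T_𝔓) · f = Card(G)` (number of primes over `𝔭`, inertia, residue degree), separable
residue extension.  Ref: Serre, *Local Fields*, Ch. I §7, Cor. to Prop. 21. [cite: SerreLocalFields1979, Ch. I §7 Cor. to Prop. 21] -/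
theorem ncard_primesOver_mul_card_inertia_mul_inertiaDeg_of_isSeparable (p : Ideal R) [p.IsMaximal]
    (P : Ideal S) [P.LiesOver p] [P.IsMaximal] [Algebra.IsSeparable (R ⧸ p) (S ⧸ P)] :
    (p.primesOver S).ncard * Nat.card (P.inertia G) * P.inertiaDeg R = Nat.card G := by
  rw [mul_assoc, ← card_stabilizer_eq_card_inertia_mul_inertiaDeg_of_isSeparable p P,
    ← Algebra.IsInvariant.orbit_eq_primesOver R S G p P]
  simpa using Nat.card_congr (MulAction.orbitProdStabilizerEquivGroup G P)

/-- **`Card(T_𝔓) = e(𝔓|𝔭)`**: the order of the inertia group is the ramification index, for a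
finite Galois group of an extension of domains `S/R` (`S` finite flat over `R`) and maximal ideals
`𝔓 | 𝔭` with separable residue extension (Mathlib's `Ideal.card_inertia_eq_ramificationIdxIn`
assumes a perfect residue field instead).
Ref: Serre, *Local Fields*, Ch. I §7, Cor. to Prop. 21 ("if `L̄/K̄` is separable ...
`[L : K_T] = e`"). [cite: SerreLocalFields1979, Ch. I §7 Cor. to Prop. 21] -/
theorem card_inertia_eq_ramificationIdxIn_of_isSeparable [IsDomain R] [IsDomain S]
    [Module.Finite R S] [Module.Flat R S] (p : Ideal R) [p.IsMaximal] (P : Ideal S) [P.LiesOver p]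
    [P.IsMaximal] [Algebra.IsSeparable (R ⧸ p) (S ⧸ P)] :
    Nat.card (P.inertia G) = Ideal.ramificationIdxIn p S := by
  have H := ncard_primesOver_mul_card_inertia_mul_inertiaDeg_of_isSeparable (G := G) p P
  have hG : Nat.card G ≠ 0 := Nat.card_pos.ne'
  have h1 : (p.primesOver S).ncard ≠ 0 := fun h0 => hG (by rw [← H, h0, zero_mul, zero_mul])
  have h2 : P.inertiaDeg R ≠ 0 := fun h0 => hG (by rw [← H, h0, mul_zero])
  rw [← Ideal.inertiaDegIn_eq_inertiaDeg p P G] at H h2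
  rwa [← Ideal.ncard_primesOver_mul_ramificationIdxIn_mul_inertiaDegIn p S G,
    mul_assoc, mul_right_inj' h1, mul_left_inj' h2] at H

end CardInertia

/-! ### Residue classes are represented by inertia invariants -/

section ResidueSurjective

variable {A B : Type*} [CommRing A] [CommRing B] [Algebra A B]
  (G : Type*) [Group G] [Finite G] [MulSemiringAction G B] [SMulCommClass G A B]

/-- **Every residue class mod `𝔓` contains an element fixed by the whole inertia group**, when
the residue extension is separable: `B^{T_𝔓} → B/𝔓` is onto (`K̄_T = L̄`, Serre).  Proof: for
`T = T_𝔓(G)` acting on `B` with ring of invariants `B^T`, the extension `(B/𝔓)/(B^T/𝔓 ∩ B^T)` is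
normal with automorphism group the image of `T` (Mathlib `Ideal.Quotient.stabilizerHom_surjective`),
which is trivial, and separable; hence it is of degree `1`.
Ref: Serre, *Local Fields*, Ch. I §7, Prop. 21 c) and Cor. (`K̄_T = L̄_s`, `= L̄` if `L̄/K̄` is
separable). [cite: SerreLocalFields1979, Ch. I §7 Prop. 21 c) and Cor.] -/
theorem exists_inertia_fixed_sub_mem (p : Ideal A) [p.IsMaximal] (P : Ideal B) [P.IsMaximal]
    [P.LiesOver p] [Algebra.IsSeparable (A ⧸ p) (B ⧸ P)] (b : B) :
    ∃ b₀ : B, (∀ g ∈ P.inertia G, g • b₀ = b₀) ∧ b - b₀ ∈ P := by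
  classical
  -- the inertia group and its ring of invariants
  set T : Subgroup G := P.inertia G with hT
  let A₁ : Subring B := FixedPoints.subring B T
  haveI : Algebra.IsInvariant A₁ B T := ⟨fun b hb ↦ ⟨⟨b, hb⟩, rfl⟩⟩
  -- `A → A₁ → B`
  have hmem : ∀ a : A, algebraMap A B a ∈ A₁ := fun a g => smul_algebraMap (g : G) a
  letI : Algebra A A₁ := ((algebraMap A B).codRestrict A₁ hmem).toAlgebra
  haveI : IsScalarTower A A₁ B := IsScalarTower.of_algebraMap_eq fun _ => rfl
  let p₁ : Ideal A₁ := P.under A₁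
  haveI : Algebra.IsIntegral A₁ B := Algebra.IsInvariant.isIntegral A₁ B T
  haveI : p₁.IsMaximal := Ideal.IsMaximal.under A₁ P
  haveI hp₁ : p₁.LiesOver p := ⟨by rw [Ideal.under_under, ← Ideal.over_def P p]⟩
  letI : Field (A ⧸ p) := Ideal.Quotient.field p
  letI : Field (A₁ ⧸ p₁) := Ideal.Quotient.field p₁
  letI : Field (B ⧸ P) := Ideal.Quotient.field P
  haveI : IsScalarTower (A ⧸ p) (A₁ ⧸ p₁) (B ⧸ P) := by
    refine IsScalarTower.of_algebraMap_eq fun x => ?_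
    obtain ⟨a, rfl⟩ := Ideal.Quotient.mk_surjective x
    rw [Ideal.Quotient.algebraMap_mk_of_liesOver, Ideal.Quotient.algebraMap_mk_of_liesOver,
      Ideal.Quotient.algebraMap_mk_of_liesOver]
    rfl
  -- the residue extension of `P` over `p₁` is Galois with trivial group
  haveI : Normal (A₁ ⧸ p₁) (B ⧸ P) := Ideal.Quotient.normal T p₁ P
  haveI : Algebra.IsSeparable (A₁ ⧸ p₁) (B ⧸ P) :=
    Algebra.isSeparable_tower_top_of_isSeparable (A ⧸ p) (A₁ ⧸ p₁) (B ⧸ P)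
  haveI : IsGalois (A₁ ⧸ p₁) (B ⧸ P) := IsGalois.mk
  have hsurj := Ideal.Quotient.stabilizerHom_surjective T p₁ P
  haveI : Subsingleton ((B ⧸ P) ≃ₐ[A₁ ⧸ p₁] (B ⧸ P)) := by
    refine ⟨fun θ₁ θ₂ => ?_⟩
    suffices h : ∀ θ : (B ⧸ P) ≃ₐ[A₁ ⧸ p₁] (B ⧸ P), θ = 1 by rw [h θ₁, h θ₂]
    intro θ
    obtain ⟨g, rfl⟩ := hsurj θ
    ext x
    obtain ⟨b, rfl⟩ := Ideal.Quotient.mk_surjective x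
    rw [Ideal.Quotient.stabilizerHom_apply, AlgEquiv.one_apply, Ideal.Quotient.eq]
    have hg : ((g : T) : G) ∈ P.inertia G := (g : T).2
    exact AddSubgroup.mem_inertia.mp hg b
  haveI : Finite ((B ⧸ P) ≃ₐ[A₁ ⧸ p₁] (B ⧸ P)) := Finite.of_subsingleton
  haveI : FiniteDimensional (A₁ ⧸ p₁) (B ⧸ P) := IsGalois.finiteDimensional_of_finite _ _
  have hrank : Module.finrank (A₁ ⧸ p₁) (B ⧸ P) = 1 := by
    rw [← IsGalois.card_aut_eq_finrank, Nat.card_of_subsingleton (1 : (B ⧸ P) ≃ₐ[A₁ ⧸ p₁] (B ⧸ P))]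
  -- hence every residue class comes from `A₁`
  have hbot : (⊥ : Subalgebra (A₁ ⧸ p₁) (B ⧸ P)) = ⊤ :=
    Subalgebra.bot_eq_top_iff_finrank_eq_one.mpr hrank
  have hx : Ideal.Quotient.mk P b ∈ (⊥ : Subalgebra (A₁ ⧸ p₁) (B ⧸ P)) := by
    rw [hbot]; exact Algebra.mem_top
  obtain ⟨y, hy⟩ := Algebra.mem_bot.mp hx
  obtain ⟨a₁, rfl⟩ := Ideal.Quotient.mk_surjective y
  rw [Ideal.Quotient.algebraMap_mk_of_liesOver] at hy
  refine ⟨(a₁ : B), fun g hg => a₁.2 ⟨g, hg⟩, ?_⟩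
  rw [← Ideal.Quotient.eq]
  exact hy.symm

end ResidueSurjective

/-! ### The `𝔓`-adic order of an element and the uniformizer criterion in a Dedekind domain -/

section Order

variable {B : Type*} [CommRing B] [IsDedekindDomain B] (P : Ideal B)

/-- The `𝔓`-adic order `v_𝔓(b) ∈ ℕ∞` of an element `b` of a Dedekind domain: the multiplicity of
`𝔓` in the principal ideal `(b)` (`⊤` for `b = 0`).  Ref: Serre, *Local Fields*, Ch. I §3
(the valuations `v_𝔭` of a Dedekind domain). [folklore] -/
def ord (b : B) : ℕ∞ :=
  emultiplicity P (Ideal.span {b})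

/-- `b ∈ 𝔓ⁿ ↔ n ≤ v_𝔓(b)`.  Ref: Serre, *Local Fields*, Ch. I §3. [folklore] -/
theorem mem_pow_iff_le_ord {b : B} {n : ℕ} : b ∈ P ^ n ↔ (n : ℕ∞) ≤ ord P b := by
  rw [ord, ← pow_dvd_iff_le_emultiplicity, Ideal.dvd_span_singleton]

/-- `v_𝔓(b c) = v_𝔓(b) + v_𝔓(c)` for `𝔓 ≠ 0` prime.  Ref: Serre, *Local Fields*, Ch. I §3. [folklore] -/
theorem ord_mul [P.IsPrime] (hP : P ≠ ⊥) (b c : B) : ord P (b * c) = ord P b + ord P c := by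
  rw [ord, ord, ord, ← Ideal.span_singleton_mul_span_singleton,
    emultiplicity_mul (Ideal.prime_of_isPrime hP inferInstance)]

/-- `v_𝔓(∏ bᵢ) = Σ v_𝔓(bᵢ)` for `𝔓 ≠ 0` prime.  Ref: Serre, *Local Fields*, Ch. I §3. [folklore] -/
theorem ord_prod [P.IsPrime] (hP : P ≠ ⊥) {ι : Type*} (s : Finset ι) (f : ι → B) :
    ord P (∏ i ∈ s, f i) = ∑ i ∈ s, ord P (f i) := by
  classical
  induction s using Finset.induction_on with
  | empty =>
    rw [Finset.prod_empty, Finset.sum_empty, ord, Ideal.span_singleton_one, emultiplicity_eq_zero,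
      Ideal.dvd_iff_le]
    exact fun h => (inferInstance : P.IsPrime).ne_top (top_le_iff.mp h)
  | insert i s hi ih => rw [Finset.prod_insert hi, Finset.sum_insert hi, ord_mul P hP, ih]

omit [IsDedekindDomain B] in
/-- `v_𝔓(0) = ⊤`. [folklore] -/
@[simp]
theorem ord_zero : ord P (0 : B) = ⊤ := by
  rw [ord, Ideal.span_singleton_eq_bot.mpr rfl, ← Ideal.zero_eq_bot, emultiplicity_zero]

/-- A unit at `𝔓` has order `0`: `v_𝔓(b) = 0 ↔ b ∉ 𝔓`. [folklore] -/
theorem ord_eq_zero_iff {b : B} : ord P b = 0 ↔ b ∉ P := by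
  rw [ord, emultiplicity_eq_zero, Ideal.dvd_span_singleton]

/-- `v_𝔓(ϖ) = 1` for `ϖ ∈ 𝔓 ∖ 𝔓²`. [folklore] -/
theorem ord_eq_one {ϖ : B} (hϖ : ϖ ∈ P) (hϖ2 : ϖ ∉ P ^ 2) : ord P ϖ = 1 := by
  rw [ord, show (1 : ℕ∞) = ((1 : ℕ) : ℕ∞) from rfl, emultiplicity_eq_coe, pow_one,
    Ideal.dvd_span_singleton, Ideal.dvd_span_singleton]
  exact ⟨hϖ, hϖ2⟩

/-- `v_𝔓(bʲ) = j · v_𝔓(b)` for `𝔓 ≠ 0` prime. [folklore] -/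
theorem ord_pow [P.IsPrime] (hP : P ≠ ⊥) (b : B) (j : ℕ) : ord P (b ^ j) = j * ord P b := by
  rw [ord, ord, ← Ideal.span_singleton_pow, emultiplicity_pow (Ideal.prime_of_isPrime hP inferInstance)]

/-- In a Dedekind domain, `𝔓ᵏ = (ϖᵏ) + 𝔓ᵏ⁺¹` for `ϖ ∈ 𝔓 ∖ 𝔓²` (`𝔓 ≠ 0` maximal): every
`c ∈ 𝔓ᵏ` is `ϖᵏ d + c'` with `c' ∈ 𝔓ᵏ⁺¹`.  Ref: Serre, *Local Fields*, Ch. I §3 / Ch. II §1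
(`𝔭ⁿ/𝔭ⁿ⁺¹` is generated by the class of `πⁿ`). [folklore] -/
theorem exists_eq_pow_mul_add_of_mem_pow [P.IsMaximal] (hP : P ≠ ⊥) {ϖ : B} (hϖ : ϖ ∈ P)
    (hϖ2 : ϖ ∉ P ^ 2) {k : ℕ} {c : B} (hc : c ∈ P ^ k) :
    ∃ d c' : B, c' ∈ P ^ (k + 1) ∧ c = ϖ ^ k * d + c' := by
  have hprime : Prime P := Ideal.prime_of_isPrime hP inferInstance
  have hϖ0 : ϖ ≠ 0 := fun h => hϖ2 (h.symm ▸ Submodule.zero_mem _)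
  have hI : Ideal.span {ϖ ^ k} ≠ ⊥ := by
    rw [Ne, Ideal.span_singleton_eq_bot]
    exact pow_ne_zero k hϖ0
  have hmult : emultiplicity P (Ideal.span {ϖ ^ k}) = k := by
    rw [← Ideal.span_singleton_pow, emultiplicity_pow hprime, ← ord, ord_eq_one P hϖ hϖ2, mul_one]
  have hsup : P ^ (k + 1) ⊔ Ideal.span {ϖ ^ k} = P ^ k := by
    rw [Ideal.irreducible_pow_sup_of_ge hI hprime.irreducible (k + 1)
        (by rw [hmult]; exact_mod_cast Nat.le_succ k),
      multiplicity_eq_of_emultiplicity_eq_some hmult]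
  have hc' : c ∈ P ^ (k + 1) ⊔ Ideal.span {ϖ ^ k} := hsup.symm ▸ hc
  obtain ⟨y, hy, z, hz, rfl⟩ := Submodule.mem_sup.mp hc'
  obtain ⟨d, rfl⟩ := Ideal.mem_span_singleton'.mp hz
  exact ⟨d, y, hy, by ring⟩

end Order

/-! ### The uniformizer criterion (Serre, Ch. IV §1, Lemma 1, (b) ⇔ (c)) in a Dedekind domain -/

section UniformizerCriterion

variable {B : Type*} [CommRing B] [IsDedekindDomain B] (P : Ideal B) [P.IsMaximal]
  {G : Type*} [Group G] [MulSemiringAction G B]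

omit [IsDedekindDomain B] [P.IsMaximal] in
/-- If `σ 𝔓 = 𝔓` then `σ` preserves every power of `𝔓`. [folklore] -/
theorem smul_mem_pow_of_smul_eq {σ : G} (hσ : σ • P = P) {m : ℕ} {x : B} (hx : x ∈ P ^ m) :
    σ • x ∈ P ^ m := by
  have h : σ • P ^ m = P ^ m := by rw [smul_pow', hσ]
  rw [← h]
  exact Ideal.smul_mem_pointwise_smul _ _ _ hx

/-- **Uniformizer criterion.**  Let `B` be a Dedekind domain, `𝔓 ≠ 0` a maximal ideal,
`ϖ ∈ 𝔓 ∖ 𝔓²`, and `σ` a ring automorphism of `B` with `σ𝔓 = 𝔓` such that every residue class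
mod `𝔓` contains a `σ`-fixed element.  Then for every `n`:
`σ b ≡ b (mod 𝔓ⁿ)` for all `b` iff `σ ϖ ≡ ϖ (mod 𝔓ⁿ)`.  This is Serre's Lemma 1, (b) ⇔ (c), with
the generator `x` of `A_L` replaced by a uniformizer (valid on the inertia group, whose residue
classes are represented by inertia invariants); proof by `𝔓ᵏ = (ϖᵏ) + 𝔓ᵏ⁺¹` and a double
induction.
Ref: Serre, *Local Fields*, Ch. IV §1, Lemma 1 (p. 61–62) and §2 Prop. 5 (p. 65:
`s ∈ G_i ⇔ s(π)/π ≡ 1 mod 𝔭_L^i` for `s ∈ G_0`). [cite: SerreLocalFields1979, Ch. IV §1 Lemma 1 and §2 Prop. 5] -/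
theorem forall_smul_sub_mem_pow_iff (hP : P ≠ ⊥) {σ : G} (hσ : σ • P = P)
    (hfix : ∀ b : B, ∃ a : B, σ • a = a ∧ b - a ∈ P) {ϖ : B} (hϖ : ϖ ∈ P) (hϖ2 : ϖ ∉ P ^ 2)
    (n : ℕ) : (∀ b : B, σ • b - b ∈ P ^ n) ↔ σ • ϖ - ϖ ∈ P ^ n := by
  refine ⟨fun h => h ϖ, fun hϖn => ?_⟩
  suffices hT : ∀ j ≤ n, ∀ b : B, σ • b - b ∈ P ^ j from hT n le_rfl
  intro j
  induction j with
  | zero =>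
    intro _ b
    rw [pow_zero, Ideal.one_eq_top]
    exact Submodule.mem_top
  | succ j ih =>
    intro hj
    have ihj := ih (Nat.le_of_succ_le hj)
    -- `U(k)`: for `k ≥ 1` and `c ∈ 𝔓ᵏ`, `σ c - c ∈ 𝔓ʲ⁺¹` (descending induction on `k ≤ j + 1`)
    have hU : ∀ d k : ℕ, k + d = j + 1 → 1 ≤ k → ∀ c ∈ P ^ k, σ • c - c ∈ P ^ (j + 1) := by
      intro d
      induction d with
      | zero =>
        intro k hk _ c hc
        rw [add_zero] at hk
        subst hk
        exact Submodule.sub_mem _ (smul_mem_pow_of_smul_eq P hσ hc) hc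
      | succ d ihd =>
        intro k hk hk1 c hc
        obtain ⟨e, c', hc', rfl⟩ := exists_eq_pow_mul_add_of_mem_pow P hP hϖ hϖ2 hc
        have h1 : (σ • ϖ) ^ k - ϖ ^ k ∈ P ^ (j + 1) := by
          obtain ⟨q, hq⟩ := sub_dvd_pow_sub_pow (σ • ϖ) ϖ k
          rw [hq]
          exact Ideal.pow_le_pow_right hj (Ideal.mul_mem_right _ _ hϖn)
        have h2 : ϖ ^ k * (σ • e - e) ∈ P ^ (j + 1) := by
          have h := Ideal.mul_mem_mul (Ideal.pow_mem_pow hϖ k) (ihj e)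
          rw [← pow_add] at h
          exact Ideal.pow_le_pow_right (by omega) h
        have h3 : σ • c' - c' ∈ P ^ (j + 1) := ihd (k + 1) (by omega) (by omega) c' hc'
        have key : σ • (ϖ ^ k * e + c') - (ϖ ^ k * e + c') =
            ((σ • ϖ) ^ k - ϖ ^ k) * (σ • e) + ϖ ^ k * (σ • e - e) + (σ • c' - c') := by
          rw [smul_add, smul_mul', smul_pow']
          ring
        rw [key]
        exact Submodule.add_mem _ (Submodule.add_mem _ (Ideal.mul_mem_right _ _ h1) h2) h3
    intro b
    obtain ⟨a, ha, hb⟩ := hfix b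
    have key : σ • b - b = σ • (b - a) - (b - a) := by rw [smul_sub, ha]; ring
    rw [key]
    exact hU j 1 (by omega) le_rfl (b - a) (by rwa [pow_one])

/-- Uniformizer criterion for the lower-numbering filtration: under the hypotheses of
`forall_smul_sub_mem_pow_iff`, `σ ∈ G_i ↔ σ ϖ - ϖ ∈ 𝔓ⁱ⁺¹`.
Ref: Serre, *Local Fields*, Ch. IV §1, Lemma 1 and §2 Prop. 5. [cite: SerreLocalFields1979, Ch. IV §1 Lemma 1 and §2 Prop. 5] -/
theorem mem_ramificationSubgroup_iff_smul_sub_mem_pow (hP : P ≠ ⊥) {σ : G} (hσ : σ • P = P)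
    (hfix : ∀ b : B, ∃ a : B, σ • a = a ∧ b - a ∈ P) {ϖ : B} (hϖ : ϖ ∈ P) (hϖ2 : ϖ ∉ P ^ 2)
    (i : ℕ) : σ ∈ P.ramificationSubgroup G i ↔ σ • ϖ - ϖ ∈ P ^ (i + 1) := by
  rw [Ideal.mem_ramificationSubgroup_iff, ← forall_smul_sub_mem_pow_iff P hP hσ hfix hϖ hϖ2]
  exact ⟨fun h => h.2, fun h => ⟨hσ, h⟩⟩

end UniformizerCriterion

/-! ### More on the `𝔓`-adic order: invariance, expansions, sums with distinct orders -/

section OrderLemmas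

variable {B : Type*} [CommRing B] [IsDedekindDomain B] (P : Ideal B)
  {G : Type*} [Group G] [MulSemiringAction G B]

omit [IsDedekindDomain B] in
/-- `b ∈ 𝔓ᵐ ↔ σ b ∈ 𝔓ᵐ` when `σ𝔓 = 𝔓`. [folklore] -/
theorem smul_mem_pow_iff_of_smul_eq {σ : G} (hσ : σ • P = P) {m : ℕ} {x : B} :
    σ • x ∈ P ^ m ↔ x ∈ P ^ m := by
  refine ⟨fun h => ?_, smul_mem_pow_of_smul_eq P hσ⟩
  have hσ' : σ⁻¹ • P = P := by rw [inv_smul_eq_iff, hσ]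
  simpa using smul_mem_pow_of_smul_eq P hσ' h

/-- `v_𝔓(σ b) = v_𝔓(b)` for `σ` in the decomposition group of `𝔓`.
Ref: Serre, *Local Fields*, Ch. I §7 (`s ∈ D` preserves `v_𝔓`). [folklore] -/
theorem ord_smul {σ : G} (hσ : σ • P = P) (b : B) : ord P (σ • b) = ord P b := by
  refine le_antisymm ?_ ?_ <;> refine ENat.forall_natCast_le_iff_le.mp fun n hn => ?_
  · rw [← mem_pow_iff_le_ord] at hn ⊢
    exact (smul_mem_pow_iff_of_smul_eq P hσ).mp hn
  · rw [← mem_pow_iff_le_ord] at hn ⊢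
    exact (smul_mem_pow_iff_of_smul_eq P hσ).mpr hn

omit [IsDedekindDomain B] in
/-- `v_𝔓(-b) = v_𝔓(b)`. [folklore] -/
@[simp]
theorem ord_neg (b : B) : ord P (-b) = ord P b := by
  rw [ord, ord, Ideal.span_singleton_neg]

omit [IsDedekindDomain B] in
/-- A polynomial with all coefficients in an ideal `I` takes values in `I`. [folklore] -/
theorem _root_.Polynomial.eval_mem_of_forall_coeff_mem {I : Ideal B} {q : Polynomial B}
    (hq : ∀ k, q.coeff k ∈ I) (b : B) : q.eval b ∈ I := by
  rw [Polynomial.eval_eq_sum_range]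
  exact Ideal.sum_mem _ fun k _ => Ideal.mul_mem_right _ _ (hq k)

/-- **Expansion in a uniformizer.**  If every residue class mod `𝔓` has a representative in the
subring `A₀`, then every `z ∈ B` is congruent mod `𝔓ⁿ` to a polynomial in `ϖ` (`ϖ ∈ 𝔓 ∖ 𝔓²`)
with coefficients in `A₀`.  Ref: Serre, *Local Fields*, Ch. II §4, Prop. 5 / Ch. I §6, Prop. 18
(expansions `Σ s_n πⁿ`). [folklore] -/
theorem exists_polynomial_sub_eval_mem_pow [P.IsMaximal] (hP : P ≠ ⊥) {ϖ : B} (hϖ : ϖ ∈ P)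
    (hϖ2 : ϖ ∉ P ^ 2) (A₀ : Subring B) (hA₀ : ∀ b : B, ∃ a ∈ A₀, b - a ∈ P) (z : B) (n : ℕ) :
    ∃ g : Polynomial A₀, z - (g.map A₀.subtype).eval ϖ ∈ P ^ n := by
  induction n with
  | zero => exact ⟨0, by simp⟩
  | succ n ih =>
    obtain ⟨g, hg⟩ := ih
    obtain ⟨d, w', hw', hw⟩ := exists_eq_pow_mul_add_of_mem_pow P hP hϖ hϖ2 hg
    obtain ⟨a, ha, hda⟩ := hA₀ d
    refine ⟨g + Polynomial.C (⟨a, ha⟩ : A₀) * Polynomial.X ^ n, ?_⟩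
    have key : z - ((g + Polynomial.C (⟨a, ha⟩ : A₀) * Polynomial.X ^ n).map A₀.subtype).eval ϖ =
        ϖ ^ n * (d - a) + w' := by
      simp only [Polynomial.map_add, Polynomial.map_mul, Polynomial.map_pow, Polynomial.map_C,
        Polynomial.map_X, Polynomial.eval_add, Polynomial.eval_mul, Polynomial.eval_pow,
        Polynomial.eval_C, Polynomial.eval_X, Subring.subtype_apply]
      linear_combination hw
    rw [key, pow_succ]
    exact Submodule.add_mem _ (Ideal.mul_mem_mul (Ideal.pow_mem_pow hϖ n) hda) hw'

/-- **Sums of terms with pairwise distinct orders.**  If the finite orders `v_𝔓(cᵢ)` are pairwise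
distinct and `Σ cᵢ ∈ 𝔓ᴺ`, then every `cᵢ ∈ 𝔓ᴺ` (ultrametric domination).
Ref: Serre, *Local Fields*, Ch. I §1, Lemma 1 (p. 6?: among `v(a_i x^{n-i})` two must be equal) and
Ch. I §6, proof of Prop. 18. [folklore] -/
theorem mem_pow_of_sum_mem_pow {ι : Type*} (s : Finset ι) (c : ι → B)
    (hinj : ∀ i ∈ s, ∀ j ∈ s, ord P (c i) = ord P (c j) → ord P (c i) ≠ ⊤ → i = j)
    {N : ℕ} (hsum : ∑ i ∈ s, c i ∈ P ^ N) : ∀ i ∈ s, c i ∈ P ^ N := by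
  classical
  induction N with
  | zero =>
    intro i _
    rw [pow_zero, Ideal.one_eq_top]
    exact Submodule.mem_top
  | succ N ih =>
    have hN := ih (Ideal.pow_le_pow_right (Nat.le_succ N) hsum)
    -- an element of `𝔓ᴺ ∖ 𝔓ᴺ⁺¹` has order exactly `N`
    have hexact : ∀ i ∈ s, c i ∉ P ^ (N + 1) → ord P (c i) = N := by
      intro i hi hci
      refine le_antisymm ?_ ((mem_pow_iff_le_ord P).mp (hN i hi))
      rw [mem_pow_iff_le_ord, not_le, Nat.cast_succ, ENat.lt_coe_add_one_iff] at hci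
      exact hci
    intro i hi
    by_contra hci
    have hothers : ∀ j ∈ s, j ≠ i → c j ∈ P ^ (N + 1) := by
      intro j hj hji
      by_contra hcj
      exact hji (hinj j hj i hi ((hexact j hj hcj).trans (hexact i hi hci).symm)
        (by rw [hexact j hj hcj]; exact ENat.coe_ne_top N))
    have hsplit : c i = ∑ j ∈ s, c j - ∑ j ∈ s.erase i, c j := by
      rw [← Finset.add_sum_erase s c hi, add_sub_cancel_right]
    refine hci ?_
    rw [hsplit]
    exact Submodule.sub_mem _ hsum (Ideal.sum_mem _ fun j hj =>
      hothers j (Finset.mem_of_mem_erase hj) (Finset.ne_of_mem_erase hj))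

end OrderLemmas

/-! ### Integral closures in a Galois extension and an intermediate field

For `R ⊆ K ⊆ F ⊆ L` (`L/K` finite Galois, `F` an intermediate field), the subgroup
`Gal(L/F) = F.fixingSubgroup ≤ Gal(L/K)` acts on `S_L = integralClosure R L` with ring of
invariants `S_F = integralClosure R F` (Mathlib's `IsGaloisGroup`), so that Hilbert theory applies
to the prime `𝔓 ∩ S_F` below a maximal ideal `𝔓` of `S_L`. -/

section IntermediateFieldTower

variable (R : Type*) {K L : Type*} [CommRing R] [Field K] [Field L] [Algebra R K] [Algebra R L]
  [Algebra K L] [IsScalarTower R K L] (F : IntermediateField K L)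

/-- The `S_F`-algebra structure on `S_L` given by the inclusion
`integralClosure R F → integralClosure R L` (a `def`, used as a local instance).
Ref: Serre, *Local Fields*, Ch. I §4 (`B_E = E ∩ B`). [folklore] -/
abbrev integralClosureAlgebra : Algebra (integralClosure R F) (integralClosure R L) :=
  (F.integralClosureInclusion R).toRingHom.toAlgebra

attribute [local instance] integralClosureAlgebra

/-- `algebraMap S_F S_L` is the inclusion. [folklore] -/
theorem algebraMap_integralClosure_apply (x : integralClosure R F) :
    algebraMap (integralClosure R F) (integralClosure R L) x = F.integralClosureInclusion R x :=
  rfl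

/-- `S_F → S_L → L` is a scalar tower (local instance). [folklore] -/
theorem integralClosure_isScalarTower_left :
    IsScalarTower (integralClosure R F) (integralClosure R L) L :=
  IsScalarTower.of_algebraMap_eq fun _ => rfl

/-- `R → S_F → S_L` is a scalar tower (local instance). [folklore] -/
theorem integralClosure_isScalarTower_bot :
    IsScalarTower R (integralClosure R F) (integralClosure R L) :=
  IsScalarTower.of_algebraMap_eq fun _ => rfl

/-- `S_F → S_L` is injective (local instance). [folklore] -/
theorem integralClosure_faithfulSMul :
    FaithfulSMul (integralClosure R F) (integralClosure R L) :=
  (faithfulSMul_iff_algebraMap_injective _ _).mpr (F.integralClosureInclusion_injective R)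

attribute [local instance] integralClosure_isScalarTower_left integralClosure_isScalarTower_bot
  integralClosure_faithfulSMul

/-- `S_L` is integral over `S_F` (local instance).  Ref: Serre, *Local Fields*, Ch. I §4. [folklore] -/
theorem integralClosure_isIntegral :
    Algebra.IsIntegral (integralClosure R F) (integralClosure R L) :=
  Algebra.IsIntegral.tower_top R

attribute [local instance] integralClosure_isIntegral

variable [IsDedekindDomain R] [IsFractionRing R K] [FiniteDimensional K L]

/-- `S_L` is a finite `S_F`-module (it is finite over `R`).  Ref: Serre, *Local Fields*, Ch. I §4,
Prop. 8. [folklore] -/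
theorem integralClosure_moduleFinite [Algebra.IsSeparable K L] :
    Module.Finite (integralClosure R F) (integralClosure R L) := by
  haveI : Module.Finite R (integralClosure R L) := IsIntegralClosure.finite R K L (integralClosure R L)
  exact Module.Finite.of_restrictScalars_finite R (integralClosure R F) (integralClosure R L)

omit [IsDedekindDomain R] [IsFractionRing R K] [FiniteDimensional K L] in
/-- `S_L` is torsion-free over `S_F`. [folklore] -/
theorem integralClosure_isTorsionFree :
    Module.IsTorsionFree (integralClosure R F) (integralClosure R L) := by
  rw [Module.isTorsionFree_iff_faithfulSMul]
  infer_instance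

/-- `Gal(L/F) = F.fixingSubgroup` is a Galois group for `S_L / S_F` in Mathlib's sense.
Ref: Serre, *Local Fields*, Ch. I §7. [folklore] -/
theorem isGaloisGroup_fixingSubgroup_integralClosure [IsGalois K L] :
    IsGaloisGroup F.fixingSubgroup (integralClosure R F) (integralClosure R L) := by
  haveI : IsFractionRing (integralClosure R F) F :=
    integralClosure.isFractionRing_of_finite_extension K F
  haveI : IsFractionRing (integralClosure R L) L :=
    integralClosure.isFractionRing_of_finite_extension K L
  haveI : IsDedekindDomain (integralClosure R F) := integralClosure.isDedekindDomain R K F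
  haveI : IsGaloisGroup F.fixingSubgroup F L :=
    IsGaloisGroup.of_fixedPoints_eq (L ≃ₐ[K] L) K L _ _ (IsGalois.fixedField_fixingSubgroup F)
  exact IsGaloisGroup.of_isFractionRing _ _ _ F L

variable [IsGalois K L] (𝔓 : Ideal (integralClosure R L)) [𝔓.IsMaximal]

omit [IsDedekindDomain R] [IsFractionRing R K] [FiniteDimensional K L] [IsGalois K L] in
/-- `𝔓 ∩ S_F` is maximal (local instance). [folklore] -/
theorem isMaximal_under_integralClosure : (𝔓.under (integralClosure R F)).IsMaximal :=
  Ideal.IsMaximal.under _ 𝔓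

omit [IsDedekindDomain R] [IsFractionRing R K] [FiniteDimensional K L] [IsGalois K L] [𝔓.IsMaximal] in
/-- `𝔓 ∩ S_F` lies over `𝔓 ∩ R` (local instance). [folklore] -/
theorem under_integralClosure_liesOver : (𝔓.under (integralClosure R F)).LiesOver (𝔓.under R) :=
  ⟨(Ideal.under_under 𝔓).symm⟩

attribute [local instance] isMaximal_under_integralClosure under_integralClosure_liesOver

/-- The residue algebra `S_F/𝔓_F → S_L/𝔓` (Mathlib's `Ideal.Quotient.algebraOfLiesOver`, registered
here as a shortcut instance for the local `S_F`-algebra structure). [folklore] -/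
abbrev residueAlgebra :
    Algebra (integralClosure R F ⧸ 𝔓.under (integralClosure R F)) (integralClosure R L ⧸ 𝔓) :=
  Ideal.Quotient.algebraOfLiesOver _ _

attribute [local instance] residueAlgebra

/-- Shortcut `SMul` instance for the residue algebra (instance search through the quotient and
subalgebra coercions is otherwise too slow). [folklore] -/
abbrev residueSMul :
    SMul (integralClosure R F ⧸ 𝔓.under (integralClosure R F)) (integralClosure R L ⧸ 𝔓) :=
  Algebra.toSMul

attribute [local instance] residueSMul

omit [IsDedekindDomain R] [IsFractionRing R K] [FiniteDimensional K L] [IsGalois K L] [𝔓.IsMaximal] in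
/-- The residue extensions along `R/𝔭 → S_F/𝔓_F → S_L/𝔓` form a scalar tower (local instance). [folklore] -/
theorem isScalarTower_residue :
    IsScalarTower (R ⧸ 𝔓.under R) (integralClosure R F ⧸ 𝔓.under (integralClosure R F))
      (integralClosure R L ⧸ 𝔓) := by
  refine IsScalarTower.of_algebraMap_eq fun x => ?_
  obtain ⟨a, rfl⟩ := Ideal.Quotient.mk_surjective x
  rw [Ideal.Quotient.algebraMap_mk_of_liesOver, Ideal.Quotient.algebraMap_mk_of_liesOver,
    Ideal.Quotient.algebraMap_mk_of_liesOver]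
  rfl

attribute [local instance] isScalarTower_residue

omit [IsDedekindDomain R] [IsFractionRing R K] [FiniteDimensional K L] [IsGalois K L] in
/-- Separability of `S_L/𝔓` over `S_F/𝔓_F` from separability over `R/𝔭`. [folklore] -/
theorem isSeparable_residue_top [Algebra.IsSeparable (R ⧸ 𝔓.under R) (integralClosure R L ⧸ 𝔓)] :
    Algebra.IsSeparable (integralClosure R F ⧸ 𝔓.under (integralClosure R F))
      (integralClosure R L ⧸ 𝔓) := by
  letI : Field (integralClosure R F ⧸ 𝔓.under (integralClosure R F)) := Ideal.Quotient.field _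
  exact Algebra.isSeparable_tower_top_of_isSeparable (R ⧸ 𝔓.under R)
    (integralClosure R F ⧸ 𝔓.under (integralClosure R F)) (integralClosure R L ⧸ 𝔓)

omit [IsDedekindDomain R] [IsFractionRing R K] [FiniteDimensional K L] [IsGalois K L] in
/-- Separability of `S_F/𝔓_F` over `R/𝔭` from separability of `S_L/𝔓` over `R/𝔭`. [folklore] -/
theorem isSeparable_residue_bot [Algebra.IsSeparable (R ⧸ 𝔓.under R) (integralClosure R L ⧸ 𝔓)] :
    Algebra.IsSeparable (R ⧸ 𝔓.under R)
      (integralClosure R F ⧸ 𝔓.under (integralClosure R F)) := by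
  letI : Field (R ⧸ 𝔓.under R) := Ideal.Quotient.field _
  letI : Field (integralClosure R F ⧸ 𝔓.under (integralClosure R F)) := Ideal.Quotient.field _
  letI : Field (integralClosure R L ⧸ 𝔓) := Ideal.Quotient.field _
  exact Algebra.isSeparable_tower_bot_of_isSeparable (R ⧸ 𝔓.under R)
    (integralClosure R F ⧸ 𝔓.under (integralClosure R F)) (integralClosure R L ⧸ 𝔓)

/-- **`e(𝔓 | 𝔓 ∩ F) = Card(T_𝔓 ∩ Gal(L/F))`**: the ramification index of `𝔓` over the prime
below it in an intermediate field `F` is the order of the inertia group of `𝔓` in `Gal(L/F)`,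
when the residue extension of `𝔓` over `𝔭 = 𝔓 ∩ R` is separable.
Ref: Serre, *Local Fields*, Ch. I §7, Prop. 21 a), Cor., and Prop. 22 a) (`T(L/F) = T(L/K) ∩ G(L/F)`). [cite: SerreLocalFields1979, Ch. I §7 Prop. 21–22] -/
theorem ramificationIdx'_under_eq_card_inertia (h𝔓 : 𝔓 ≠ ⊥)
    [Algebra.IsSeparable (R ⧸ 𝔓.under R) (integralClosure R L ⧸ 𝔓)] :
    (𝔓.under (integralClosure R F)).ramificationIdx' 𝔓 = Nat.card (𝔓.inertia F.fixingSubgroup) := by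
  haveI := isGaloisGroup_fixingSubgroup_integralClosure R F (K := K) (L := L)
  haveI := integralClosure_moduleFinite R F (K := K) (L := L)
  haveI := integralClosure_isTorsionFree R F (K := K) (L := L)
  haveI : IsDedekindDomain (integralClosure R F) := integralClosure.isDedekindDomain R K F
  haveI : IsDedekindDomain (integralClosure R L) := integralClosure.isDedekindDomain R K L
  haveI := isSeparable_residue_top R F 𝔓 (K := K) (L := L)
  have hp : 𝔓.under (integralClosure R F) ≠ ⊥ := Ideal.IsIntegral.comap_ne_bot _ h𝔓
  rw [Ideal.ramificationIdx'_eq_ramificationIdx _ 𝔓 hp,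
    ← Ideal.ramificationIdxIn_eq_ramificationIdx (𝔓.under (integralClosure R F)) 𝔓 F.fixingSubgroup,
    card_inertia_eq_ramificationIdxIn_of_isSeparable (G := F.fixingSubgroup)
      (𝔓.under (integralClosure R F)) 𝔓]

/-- **`v_𝔓(y) = e(𝔓|𝔓_F) · v_{𝔓_F}(y)`** for `y ∈ S_F`: the valuation of `𝔓` prolongs that of
`𝔓 ∩ F` with index `e`.  Ref: Serre, *Local Fields*, Ch. I §4, before Prop. 11 ("`v_𝔓(x) = e_𝔓 v_𝔭(x)`
if `x ∈ K`"). [cite: SerreLocalFields1979, Ch. I §4 (before Prop. 11)] -/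
theorem ord_algebraMap_integralClosure (h𝔓 : 𝔓 ≠ ⊥) (y : integralClosure R F) :
    ord 𝔓 (algebraMap _ (integralClosure R L) y) =
      (𝔓.under (integralClosure R F)).ramificationIdx' 𝔓 * ord (𝔓.under (integralClosure R F)) y := by
  haveI : IsDedekindDomain (integralClosure R F) := integralClosure.isDedekindDomain R K F
  haveI : IsDedekindDomain (integralClosure R L) := integralClosure.isDedekindDomain R K L
  have hp : 𝔓.under (integralClosure R F) ≠ ⊥ := Ideal.IsIntegral.comap_ne_bot _ h𝔓
  by_cases hy : y = 0
  · subst hy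
    rw [map_zero, ord_zero, ord_zero, ENat.mul_top]
    exact_mod_cast Ideal.IsDedekindDomain.ramificationIdx'_ne_zero (Ideal.map_ne_bot_of_ne_bot hp)
      inferInstance (Ideal.map_le_iff_le_comap.mpr le_rfl)
  rw [ord, ord, ← Ideal.IsDedekindDomain.emultiplicity_map_eq_ramificationIdx'_mul
    (by rwa [Ne, Ideal.span_singleton_eq_bot])
    (Ideal.prime_of_isPrime hp inferInstance).irreducible
    (Ideal.prime_of_isPrime h𝔓 inferInstance).irreducible h𝔓, Ideal.map_span, Set.image_singleton]

end IntermediateFieldTower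

end Literature.NumberTheory.GaloisRepresentations
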